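import Literature.NumberTheory.Sieve.BombieriFriedlanderIwaniecTheorem9SwitchMain
import HarnessLib

/-!
# BFI 1986, Theorem 9 — the `q ↔ s` switch at the level of `Λ`, III: the lengths of the nominal intervals

Topic `Literature/NumberTheory/Sieve`; continuation of `…Theorem9SwitchMain`.  After the switch the
subtracted mean values of Theorem 9 for the block `P < q ≤ P'` have to be matched with the mean
values of the switched cells; both are `κ(r)` times a logarithmic factor (`y log(P'/P)` for the
block, `∑_j ℓ_j log λ` for the cells, `ℓ_j` the length of the `j`-th nominal interval), by the
window estimates of `…Theorem7StarSwitchHarmonic`.  That the two logarithmic factors agree,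

* **`BFI.abs_sum_ell_mul_log_sub_le`**: `|∑_{j<J} ℓ_j log λ − y log(P'/P)| ≤ 27λ η y + 14λ y/P + 2λ P' R₀ + 8λ y/(η s_lo)`
  (`s_lo` a lower bound for the cells carrying a nonempty nominal interval),

is proved here WITHOUT integration, by running the switch once more for the counting function `1`
in place of `Λ` (`BFI.sum_Ioc_cntSum_eq_sum_swCnt`): the number of `n ∈ (y, 2y]` in a residue class
to modulus `d` is `y/d + O(1)` on both sides (`BFI.abs_cntSum_sub_le`, `BFI.abs_swCnt_sub_le`), the
harmonic sums over the `q`-block and over the `s`-cells are logarithms up to `O(1/U)`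
(`abs_sum_Ioc_inv_sub_log_le` of the tree; geometric tails by Mathlib's `geom_sum_Ico_le_of_lt_one`), and the true lengths differ from the nominal ones by
the layers (`BFI.ell_le_trueLen`, `BFI.trueLen_le_ell_add`) — BFI's remark that `q` and `s`
"appear symmetrically" (§13, p. 241), applied to the constant sequence.  Everything is PROVED; no
named fact is introduced.

## References

* E. Bombieri, J. B. Friedlander, H. Iwaniec, Acta Math. 156 (1986), 203–251, §13 p. 241–242.
  [BombieriFriedlanderIwaniecActa1986]
-/

open Finset Real
open scoped ArithmeticFunction.vonMangoldt ArithmeticFunction.sigma Chebyshev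

namespace Literature.NumberTheory.Sieve

namespace BFI

/-! ### The switch for the counting function -/

/-- `#{y < n ≤ 2y : d ∣ n − a}` as a sum of indicators. [folklore] -/
noncomputable def cntSum (a : ℤ) (y : ℝ) (d : ℕ) : ℝ :=
  ∑ n ∈ Ioc ⌊y⌋₊ ⌊2 * y⌋₊, (if (y < (n : ℝ) ∧ (n : ℝ) ≤ 2 * y) ∧ (d : ℤ) ∣ (n : ℤ) - a then (1 : ℝ) else 0)

/-- The switched count at `(r, s)`: `#{y < n ≤ 2y : sr ∣ n − a, P rs < n − a ≤ P' rs}`. [folklore] -/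
noncomputable def swCnt (a : ℤ) (y P P' : ℝ) (r s : ℕ) : ℝ :=
  ∑ n ∈ Ioc ⌊y⌋₊ ⌊2 * y⌋₊,
    (if (y < (n : ℝ) ∧ (n : ℝ) ≤ 2 * y) ∧ ((s * r : ℕ) : ℤ) ∣ (n : ℤ) - a ∧
        P * r * s < ((n : ℤ) - a : ℤ) ∧ (((n : ℤ) - a : ℤ) : ℝ) ≤ P' * r * s then (1 : ℝ) else 0)

/-- **The switch for the counting function** (as `BFI.sum_Ioc_ivlCongr_eq_sum_swTrue` with `Λ`
replaced by `1`): `∑_{⌊P⌋<q≤⌊P'⌋} cntSum(qr) = ∑_{s ≤ ⌊s_hi⌋} swCnt(r, s)`.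
[cite: BombieriFriedlanderIwaniecActa1986, §13 p. 241–242] -/
theorem sum_Ioc_cntSum_eq_sum_swCnt (a : ℤ) {y : ℝ} (hy : 1 ≤ y) (hay : |(a : ℝ)| ≤ y) {r : ℕ}
    {R₀ : ℝ} (hR₀ : 0 < R₀) (hr : R₀ < r) {P P' : ℝ} (hP : 0 < P) :
    ∑ q ∈ Ioc ⌊P⌋₊ ⌊P'⌋₊, cntSum a y (q * r) = ∑ s ∈ Icc 1 ⌊sHi a y P R₀⌋₊, swCnt a y P P' r s := by
  have hr0 : 0 < r := by
    have : (0 : ℝ) < r := hR₀.trans hr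
    exact_mod_cast this
  have hpos : ∀ n ∈ Ioc ⌊y⌋₊ ⌊2 * y⌋₊, a < (n : ℤ) := by
    intro n hn
    have hb := mem_Ioc_floor_bounds (zero_le_one.trans hy) hn
    have : (a : ℝ) < n := by linarith [le_abs_self (a : ℝ)]
    exact_mod_cast this
  set S' : ℕ := ⌊sHi a y P R₀⌋₊ with hS'
  have hS'1 : sHi a y P R₀ < (S' : ℝ) + 1 := Nat.lt_floor_add_one _
  have hstrip : ∀ n ∈ Ioc ⌊y⌋₊ ⌊2 * y⌋₊, (((n : ℤ) - a : ℤ) : ℝ) ≤ P * r * ((S' : ℝ) + 1) := by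
    intro n hn
    have hb := mem_Ioc_floor_bounds (zero_le_one.trans hy) hn
    push_cast
    have h1 : (n : ℝ) - a ≤ 2 * y - a := by linarith
    have h2 : 2 * y - a = sHi a y P R₀ * (P * R₀) := by rw [sHi]; field_simp
    have h3 : sHi a y P R₀ * (P * R₀) ≤ ((S' : ℝ) + 1) * (P * R₀) :=
      mul_le_mul_of_nonneg_right hS'1.le (by positivity)
    have h4 : ((S' : ℝ) + 1) * (P * R₀) ≤ ((S' : ℝ) + 1) * (P * r) := by
      refine mul_le_mul_of_nonneg_left ?_ (by positivity)
      exact mul_le_mul_of_nonneg_left hr.le hP.le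
    linarith
  have h := switch_sum_eq' a hr0 hP (Ioc ⌊y⌋₊ ⌊2 * y⌋₊) (fun n : ℕ => y < (n : ℝ) ∧ (n : ℝ) ≤ 2 * y)
    (fun _ => (1 : ℝ)) hpos hstrip (P' := P')
  unfold cntSum swCnt
  push_cast at h ⊢
  rw [h]

/-! ### Counting residue classes in `(y, 2y]` and in the true ranges -/

/-- **`cntSum(d) = y/d + O(2)`** (`d ≥ 1`, `y ≥ 1`). [folklore] -/
theorem abs_cntSum_sub_le (a : ℤ) {y : ℝ} (hy : 1 ≤ y) {d : ℕ} (hd : 0 < d) :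
    |cntSum a y d - y / d| ≤ 2 := by
  have hy0 : 0 ≤ y := zero_le_one.trans hy
  have hdr : (0 : ℝ) < d := by exact_mod_cast hd
  have hd1 : (1 : ℝ) ≤ d := by exact_mod_cast hd
  -- `cntSum` is a cardinality
  have hc : cntSum a y d = (((Ioc ⌊y⌋₊ ⌊2 * y⌋₊).filter (fun n : ℕ => (d : ℤ) ∣ (n : ℤ) - a)).card : ℝ) := by
    unfold cntSum
    rw [← Finset.sum_filter]
    have hsets : (Ioc ⌊y⌋₊ ⌊2 * y⌋₊).filter (fun n : ℕ => (y < (n : ℝ) ∧ (n : ℝ) ≤ 2 * y) ∧ (d : ℤ) ∣ (n : ℤ) - a) =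
        (Ioc ⌊y⌋₊ ⌊2 * y⌋₊).filter (fun n : ℕ => (d : ℤ) ∣ (n : ℤ) - a) := by
      refine Finset.filter_congr fun n hn => ?_
      have hb := mem_Ioc_floor_bounds hy0 hn
      exact ⟨fun h => h.2, fun h => ⟨hb, h⟩⟩
    rw [hsets, Finset.sum_const, nsmul_eq_mul, mul_one]
  rw [hc]
  have hAB : ⌊y⌋₊ ≤ ⌊2 * y⌋₊ := Nat.floor_le_floor (by linarith)
  have hup := card_Ioc_filter_intCast_dvd_sub_le hd a hAB
  have hlo := card_Ioc_filter_intCast_dvd_sub_ge hd a ⌊y⌋₊ ⌊2 * y⌋₊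
  -- `⌊2y⌋ - ⌊y⌋ ∈ [y - 1, y + 1]`
  have h1 : (⌊2 * y⌋₊ : ℝ) - ⌊y⌋₊ ≤ y + 1 := by
    have := Nat.floor_le (show 0 ≤ 2 * y by linarith)
    have := Nat.lt_floor_add_one y
    linarith
  have h2 : y - 1 ≤ (⌊2 * y⌋₊ : ℝ) - ⌊y⌋₊ := by
    have := Nat.floor_le hy0
    have := Nat.lt_floor_add_one (2 * y)
    linarith
  have h3 : ((⌊2 * y⌋₊ : ℝ) - ⌊y⌋₊) / d ≤ y / d + 1 := by
    calc ((⌊2 * y⌋₊ : ℝ) - ⌊y⌋₊) / d ≤ (y + 1) / d := div_le_div_of_nonneg_right h1 hdr.le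
      _ = y / d + 1 / d := by rw [add_div]
      _ ≤ y / d + 1 := by gcongr; rw [div_le_one hdr]; exact hd1
  have h4 : y / d - 1 ≤ ((⌊2 * y⌋₊ : ℝ) - ⌊y⌋₊) / d := by
    calc y / d - 1 ≤ y / d - 1 / d := by gcongr; rw [div_le_one hdr]; exact hd1
      _ = (y - 1) / d := by rw [sub_div]
      _ ≤ _ := div_le_div_of_nonneg_right h2 hdr.le
  rw [abs_le]
  constructor <;> linarith

/-- The true range of `n` at `(r, s)`: lower end `u = max(y, a + P rs)`. [folklore] -/
noncomputable def tLo (a : ℤ) (y P : ℝ) (r s : ℕ) : ℝ := max y (a + P * r * s)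

/-- The true range of `n` at `(r, s)`: upper end `v = min(2y, a + P' rs)`. [folklore] -/
noncomputable def tHi (a : ℤ) (y P' : ℝ) (r s : ℕ) : ℝ := min (2 * y) (a + P' * r * s)

/-- The true length `(v − u)⁺`. [folklore] -/
noncomputable def trueLen (a : ℤ) (y P P' : ℝ) (r s : ℕ) : ℝ := max 0 (tHi a y P' r s - tLo a y P r s)

/-- `y ≤ tLo`. [folklore] -/
theorem le_tLo (a : ℤ) (y P : ℝ) (r s : ℕ) : y ≤ tLo a y P r s := by unfold tLo; exact le_max_left _ _

/-- `tHi ≤ 2y`. [folklore] -/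
theorem tHi_le (a : ℤ) (y P' : ℝ) (r s : ℕ) : tHi a y P' r s ≤ 2 * y := by unfold tHi; exact min_le_left _ _

/-- `swCnt(r, s)` is the number of `n ∈ (⌊u⌋, ⌊v⌋]` with `sr ∣ n − a`. [folklore] -/
theorem swCnt_eq_card (a : ℤ) {y P P' : ℝ} (hy : 0 ≤ y) (r s : ℕ) :
    swCnt a y P P' r s =
      (((Ioc ⌊tLo a y P r s⌋₊ ⌊tHi a y P' r s⌋₊).filter
        (fun n : ℕ => ((s * r : ℕ) : ℤ) ∣ (n : ℤ) - a)).card : ℝ) := by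
  unfold swCnt
  -- rewrite the strip as the interval condition `tLo < n ≤ tHi`
  have hcond : ∀ n : ℕ, ((y < (n : ℝ) ∧ (n : ℝ) ≤ 2 * y) ∧ ((s * r : ℕ) : ℤ) ∣ (n : ℤ) - a ∧
        P * r * s < ((n : ℤ) - a : ℤ) ∧ (((n : ℤ) - a : ℤ) : ℝ) ≤ P' * r * s) ↔
      ((tLo a y P r s < (n : ℝ) ∧ (n : ℝ) ≤ tHi a y P' r s) ∧ ((s * r : ℕ) : ℤ) ∣ (n : ℤ) - a) := by
    intro n
    rw [tLo, tHi, max_lt_iff, le_min_iff]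
    push_cast
    constructor
    · rintro ⟨⟨h1, h2⟩, hd, h3, h4⟩; exact ⟨⟨⟨h1, by linarith⟩, h2, by linarith⟩, hd⟩
    · rintro ⟨⟨⟨h1, h3⟩, h2, h4⟩, hd⟩; exact ⟨⟨h1, h2⟩, hd, by linarith, by linarith⟩
  simp_rw [hcond]
  rw [sum_Ioc_floor_ivl_eq hy (le_tLo a y P r s) (tHi_le a y P' r s), ← Finset.sum_filter, Finset.sum_const,
    nsmul_eq_mul, mul_one]

/-- **`swCnt(r, s) = trueLen/(sr) + O(2)`** (`r, s ≥ 1`, `y ≥ 0`). [folklore] -/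
theorem abs_swCnt_sub_le (a : ℤ) {y P P' : ℝ} (hy : 0 ≤ y) {r s : ℕ} (hr : 0 < r) (hs : 0 < s) :
    |swCnt a y P P' r s - trueLen a y P P' r s / ((s * r : ℕ) : ℝ)| ≤ 2 := by
  have hd : 0 < s * r := Nat.mul_pos hs hr
  have hdr : (0 : ℝ) < ((s * r : ℕ) : ℝ) := by exact_mod_cast hd
  have hd1 : (1 : ℝ) ≤ ((s * r : ℕ) : ℝ) := by exact_mod_cast hd
  rw [swCnt_eq_card a hy r s]
  set u := tLo a y P r s with hu
  set v := tHi a y P' r s with hv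
  have hu0 : 0 ≤ u := le_trans hy (le_max_left _ _)
  rcases le_or_gt u v with huv | huv
  · have hlen : trueLen a y P P' r s = v - u := by rw [trueLen, ← hu, ← hv, max_eq_right (by linarith)]
    rw [hlen]
    have hAB : ⌊u⌋₊ ≤ ⌊v⌋₊ := Nat.floor_le_floor huv
    have hup := card_Ioc_filter_intCast_dvd_sub_le hd a hAB
    have hlo := card_Ioc_filter_intCast_dvd_sub_ge hd a ⌊u⌋₊ ⌊v⌋₊
    have h1 : (⌊v⌋₊ : ℝ) - ⌊u⌋₊ ≤ v - u + 1 := by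
      have := Nat.floor_le (hu0.trans huv); have := Nat.lt_floor_add_one u; linarith
    have h2 : v - u - 1 ≤ (⌊v⌋₊ : ℝ) - ⌊u⌋₊ := by
      have := Nat.floor_le hu0; have := Nat.lt_floor_add_one v; linarith
    have h3 : ((⌊v⌋₊ : ℝ) - ⌊u⌋₊) / ((s * r : ℕ) : ℝ) ≤ (v - u) / ((s * r : ℕ) : ℝ) + 1 := by
      calc ((⌊v⌋₊ : ℝ) - ⌊u⌋₊) / ((s * r : ℕ) : ℝ) ≤ (v - u + 1) / ((s * r : ℕ) : ℝ) :=
            div_le_div_of_nonneg_right h1 hdr.le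
        _ = (v - u) / ((s * r : ℕ) : ℝ) + 1 / ((s * r : ℕ) : ℝ) := by rw [add_div]
        _ ≤ _ := by gcongr; rw [div_le_one hdr]; exact hd1
    have h4 : (v - u) / ((s * r : ℕ) : ℝ) - 1 ≤ ((⌊v⌋₊ : ℝ) - ⌊u⌋₊) / ((s * r : ℕ) : ℝ) := by
      calc (v - u) / ((s * r : ℕ) : ℝ) - 1 ≤ (v - u) / ((s * r : ℕ) : ℝ) - 1 / ((s * r : ℕ) : ℝ) := by
            gcongr; rw [div_le_one hdr]; exact hd1
        _ = (v - u - 1) / ((s * r : ℕ) : ℝ) := by rw [← sub_div]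
        _ ≤ _ := div_le_div_of_nonneg_right h2 hdr.le
    rw [abs_le]; constructor <;> linarith
  · -- empty range
    have hlen : trueLen a y P P' r s = 0 := by rw [trueLen, ← hu, ← hv, max_eq_left (by linarith)]
    have hIoc : Ioc ⌊u⌋₊ ⌊v⌋₊ = ∅ := Finset.Ioc_eq_empty_of_le (Nat.floor_le_floor huv.le)
    rw [hlen, hIoc]
    simp

/-! ### True lengths against the nominal lengths -/

/-- The nominal length of the `j`-th cell: `ℓ_j = (cHi_j − cLo_j)⁺`. [folklore] -/
noncomputable def ell (a : ℤ) (y P P' R₀ lam : ℝ) (j : ℕ) : ℝ :=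
  max 0 (cHi a y P' R₀ (sLow (sHi a y P R₀) lam j) - cLo a y P R₀ lam (sLow (sHi a y P R₀) lam j))

/-- `0 ≤ ℓ_j ≤ y` (`y ≥ 0`). [folklore] -/
theorem ell_bounds (a : ℤ) {y : ℝ} (hy : 0 ≤ y) (P P' R₀ lam : ℝ) (j : ℕ) :
    0 ≤ ell a y P P' R₀ lam j ∧ ell a y P P' R₀ lam j ≤ y := by
  refine ⟨le_max_left _ _, max_le hy ?_⟩
  have h1 := cHi_le a y P' R₀ (sLow (sHi a y P R₀) lam j)
  have h2 := le_cLo a y P R₀ lam (sLow (sHi a y P R₀) lam j)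
  linarith

/-- The threshold `s_lo = (y − a)/(P' R₀)`: cells carrying a nonempty nominal interval have `S_j > s_lo`.
[folklore] -/
noncomputable def sLoT (a : ℤ) (y P' R₀ : ℝ) : ℝ := (y - a) / (P' * R₀)

/-- `ℓ_j > 0 ⇒ S_j > s_lo` (`P' R₀ > 0`). [folklore] -/
theorem sLoT_lt_of_ell_pos (a : ℤ) {y P P' R₀ lam : ℝ} (hP' : 0 < P') (hR₀ : 0 < R₀) {j : ℕ}
    (h : 0 < ell a y P P' R₀ lam j) : sLoT a y P' R₀ < sLow (sHi a y P R₀) lam j := by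
  rw [ell] at h
  have h1 : 0 < cHi a y P' R₀ (sLow (sHi a y P R₀) lam j) - cLo a y P R₀ lam (sLow (sHi a y P R₀) lam j) := by
    rcases lt_max_iff.1 h with h0 | h0
    · exact absurd h0 (lt_irrefl _)
    · exact h0
  have h2 : y < (a : ℝ) + P' * R₀ * sLow (sHi a y P R₀) lam j := by
    have hlo := le_cLo a y P R₀ lam (sLow (sHi a y P R₀) lam j)
    have hhi : cHi a y P' R₀ (sLow (sHi a y P R₀) lam j) ≤ a + P' * R₀ * sLow (sHi a y P R₀) lam j :=
      min_le_right _ _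
    linarith
  rw [sLoT, div_lt_iff₀ (by positivity)]
  linarith

/-- **Nominal inside true**: on the cell, `ℓ_j ≤ trueLen(r, s)`. [folklore] -/
theorem ell_le_trueLen (a : ℤ) {y P P' R₀ lam : ℝ} (hP : 0 ≤ P) (hP' : 0 ≤ P') (hR₀ : 0 ≤ R₀)
    {j r s : ℕ} (hS : 0 ≤ sLow (sHi a y P R₀) lam j) (hr1 : R₀ < r) (hr2 : (r : ℝ) ≤ lam * R₀)
    (hs1 : sLow (sHi a y P R₀) lam j < s) (hs2 : (s : ℝ) ≤ lam * sLow (sHi a y P R₀) lam j) :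
    ell a y P P' R₀ lam j ≤ trueLen a y P P' r s := by
  set S := sLow (sHi a y P R₀) lam j with hS'
  have hr0 : (0 : ℝ) ≤ r := Nat.cast_nonneg _
  have hs0 : (0 : ℝ) ≤ s := Nat.cast_nonneg _
  have hRS : R₀ * S ≤ (r : ℝ) * s := mul_le_mul hr1.le hs1.le hS hr0
  have hrslam : (r : ℝ) * s ≤ lam ^ 2 * R₀ * S := by
    calc (r : ℝ) * s ≤ (lam * R₀) * (lam * S) := mul_le_mul hr2 hs2 hs0 (by nlinarith [hr1, hR₀])
      _ = lam ^ 2 * R₀ * S := by ring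
  have hlo : tLo a y P r s ≤ cLo a y P R₀ lam S := by
    rw [tLo, cLo]
    refine max_le_max le_rfl ?_
    have : P * (r * s) ≤ P * (lam ^ 2 * R₀ * S) := mul_le_mul_of_nonneg_left hrslam hP
    nlinarith
  have hhi : cHi a y P' R₀ S ≤ tHi a y P' r s := by
    rw [tHi, cHi]
    refine min_le_min le_rfl ?_
    have : P' * (R₀ * S) ≤ P' * (r * s) := mul_le_mul_of_nonneg_left hRS hP'
    nlinarith
  rw [ell, trueLen, ← hS']
  exact max_le_max le_rfl (by linarith)

/-- **True within nominal plus layers**: on the cell (`P' ≤ 2P`, `λ² − 1 ≤ 3η`),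
`trueLen(r, s) ≤ ℓ_j + 9ηP · rs`. [cite: BombieriFriedlanderIwaniecActa1986, §13 p. 242] -/
theorem trueLen_le_ell_add (a : ℤ) {y P P' R₀ lam η : ℝ} (hP : 0 ≤ P) (hPP' : P ≤ P')
    (hP'2 : P' ≤ 2 * P) (hR₀ : 0 ≤ R₀) (hη : 0 ≤ η) (hlam : 1 ≤ lam) (hlamη : lam ^ 2 - 1 ≤ 3 * η)
    {j r s : ℕ} (hS : 0 ≤ sLow (sHi a y P R₀) lam j) (hr1 : R₀ < r) (hr2 : (r : ℝ) ≤ lam * R₀)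
    (hs1 : sLow (sHi a y P R₀) lam j < s) (hs2 : (s : ℝ) ≤ lam * sLow (sHi a y P R₀) lam j) :
    trueLen a y P P' r s ≤ ell a y P P' R₀ lam j + 9 * η * P * ((r : ℝ) * s) := by
  set S := sLow (sHi a y P R₀) lam j with hS'
  have hP' : 0 ≤ P' := hP.trans hPP'
  have hr0 : (0 : ℝ) ≤ r := Nat.cast_nonneg _
  have hs0 : (0 : ℝ) ≤ s := Nat.cast_nonneg _
  have hRS : R₀ * S ≤ (r : ℝ) * s := mul_le_mul hr1.le hs1.le hS hr0
  have hrslam : (r : ℝ) * s ≤ lam ^ 2 * R₀ * S := by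
    calc (r : ℝ) * s ≤ (lam * R₀) * (lam * S) := mul_le_mul hr2 hs2 hs0 (by nlinarith [hr1, hR₀])
      _ = lam ^ 2 * R₀ * S := by ring
  have hlamge : 0 ≤ lam ^ 2 - 1 := by nlinarith
  -- the two gaps
  have hgap1 : lam ^ 2 * R₀ * S - (r : ℝ) * s ≤ 3 * η * ((r : ℝ) * s) := by
    calc lam ^ 2 * R₀ * S - (r : ℝ) * s ≤ lam ^ 2 * R₀ * S - R₀ * S := by linarith
      _ = (lam ^ 2 - 1) * (R₀ * S) := by ring
      _ ≤ (3 * η) * (r * s) := mul_le_mul hlamη hRS (by positivity) (by positivity)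
      _ = 3 * η * (r * s) := by ring
  have hgap2 : (r : ℝ) * s - R₀ * S ≤ 3 * η * ((r : ℝ) * s) := by
    calc (r : ℝ) * s - R₀ * S ≤ lam ^ 2 * R₀ * S - R₀ * S := by linarith
      _ = (lam ^ 2 - 1) * (R₀ * S) := by ring
      _ ≤ (3 * η) * (r * s) := mul_le_mul hlamη hRS (by positivity) (by positivity)
      _ = 3 * η * (r * s) := by ring
  -- `tHi − cHi ≤ P'·gap2`, `cLo − tLo ≤ P·gap1`
  have h1 : tHi a y P' r s - cHi a y P' R₀ S ≤ 6 * η * P * ((r : ℝ) * s) := by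
    rw [tHi, cHi]
    have hmin : min (2 * y) ((a : ℝ) + P' * r * s) - min (2 * y) ((a : ℝ) + P' * R₀ * S) ≤
        P' * ((r : ℝ) * s - R₀ * S) := by
      have : (a : ℝ) + P' * r * s = ((a : ℝ) + P' * R₀ * S) + P' * ((r : ℝ) * s - R₀ * S) := by ring
      rw [this]
      have hnn : 0 ≤ P' * ((r : ℝ) * s - R₀ * S) := mul_nonneg hP' (by linarith)
      rcases le_total (2 * y) ((a : ℝ) + P' * R₀ * S) with h | h
      · rw [min_eq_left h, min_eq_left (by linarith)]; linarith
      · rw [min_eq_right h]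
        have := min_le_right (2 * y) ((a : ℝ) + P' * R₀ * S + P' * ((r : ℝ) * s - R₀ * S))
        linarith
    calc _ ≤ P' * ((r : ℝ) * s - R₀ * S) := hmin
      _ ≤ (2 * P) * (3 * η * ((r : ℝ) * s)) := mul_le_mul hP'2 hgap2 (by linarith) (by positivity)
      _ = 6 * η * P * ((r : ℝ) * s) := by ring
  have h2 : cLo a y P R₀ lam S - tLo a y P r s ≤ 3 * η * P * ((r : ℝ) * s) := by
    rw [cLo, tLo]
    have hmax : max y ((a : ℝ) + P * lam ^ 2 * R₀ * S) - max y ((a : ℝ) + P * r * s) ≤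
        P * (lam ^ 2 * R₀ * S - (r : ℝ) * s) := by
      have e : (a : ℝ) + P * lam ^ 2 * R₀ * S = ((a : ℝ) + P * r * s) + P * (lam ^ 2 * R₀ * S - (r : ℝ) * s) := by ring
      rw [e]
      have hnn : 0 ≤ P * (lam ^ 2 * R₀ * S - (r : ℝ) * s) := mul_nonneg hP (by linarith)
      rcases le_total y ((a : ℝ) + P * r * s) with h | h
      · rw [max_eq_right h, max_eq_right (by linarith)]; linarith
      · rw [max_eq_left h]
        have hm : max y ((a : ℝ) + P * r * s + P * (lam ^ 2 * R₀ * S - (r : ℝ) * s)) ≤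
            y + P * (lam ^ 2 * R₀ * S - (r : ℝ) * s) := max_le (by linarith) (by linarith)
        linarith
    calc _ ≤ P * (lam ^ 2 * R₀ * S - (r : ℝ) * s) := hmax
      _ ≤ P * (3 * η * ((r : ℝ) * s)) := mul_le_mul_of_nonneg_left hgap1 hP
      _ = 3 * η * P * ((r : ℝ) * s) := by ring
  -- assemble
  rw [trueLen, ell, ← hS']
  have hell0 : 0 ≤ max 0 (cHi a y P' R₀ S - cLo a y P R₀ lam S) := le_max_left _ _
  have hcc : cHi a y P' R₀ S - cLo a y P R₀ lam S ≤ max 0 (cHi a y P' R₀ S - cLo a y P R₀ lam S) :=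
    le_max_right _ _
  refine max_le (by positivity) ?_
  have : tHi a y P' r s - tLo a y P r s =
      (tHi a y P' r s - cHi a y P' R₀ S) + (cHi a y P' R₀ S - cLo a y P R₀ lam S) +
        (cLo a y P R₀ lam S - tLo a y P r s) := by ring
  rw [this]
  linarith

/-! ### Elementary estimates for logarithms and floors -/

/-- For `P ≥ 2`: `|log(⌊P'⌋/⌊P⌋) − log(P'/P)| ≤ 4/P` (`P ≤ P'`). [folklore] -/
theorem abs_log_floor_div_floor_sub_le {P P' : ℝ} (hP : 2 ≤ P) (hPP' : P ≤ P') :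
    |Real.log ((⌊P'⌋₊ : ℝ) / ⌊P⌋₊) - Real.log (P' / P)| ≤ 4 / P := by
  have hP0 : 0 < P := by linarith
  have hP'0 : 0 < P' := by linarith
  have hfP : (1 : ℝ) ≤ ⌊P⌋₊ := by
    have : (1 : ℕ) ≤ ⌊P⌋₊ := Nat.le_floor (by norm_num; linarith)
    exact_mod_cast this
  have hfP' : (1 : ℝ) ≤ ⌊P'⌋₊ := by
    have : (1 : ℕ) ≤ ⌊P'⌋₊ := Nat.le_floor (by norm_num; linarith)
    exact_mod_cast this
  have hfP0 : (0 : ℝ) < ⌊P⌋₊ := by linarith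
  have hfP'0 : (0 : ℝ) < ⌊P'⌋₊ := by linarith
  have hPfl : (⌊P⌋₊ : ℝ) ≤ P := Nat.floor_le hP0.le
  have hP'fl : (⌊P'⌋₊ : ℝ) ≤ P' := Nat.floor_le hP'0.le
  have hPlt : P < ⌊P⌋₊ + 1 := Nat.lt_floor_add_one P
  have hP'lt : P' < ⌊P'⌋₊ + 1 := Nat.lt_floor_add_one P'
  -- `log P − log ⌊P⌋ ∈ [0, 1/⌊P⌋]`, same for `P'`
  have hA : 0 ≤ Real.log P - Real.log ⌊P⌋₊ ∧ Real.log P - Real.log ⌊P⌋₊ ≤ 1 / ⌊P⌋₊ := by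
    rw [← Real.log_div hP0.ne' hfP0.ne']
    refine ⟨Real.log_nonneg (by rw [le_div_iff₀ hfP0]; linarith), ?_⟩
    have := Real.log_le_sub_one_of_pos (show 0 < P / ⌊P⌋₊ by positivity)
    have e : P / ⌊P⌋₊ - 1 = (P - ⌊P⌋₊) / ⌊P⌋₊ := by field_simp
    rw [e] at this
    refine this.trans ?_
    exact div_le_div_of_nonneg_right (by linarith) hfP0.le
  have hB : 0 ≤ Real.log P' - Real.log ⌊P'⌋₊ ∧ Real.log P' - Real.log ⌊P'⌋₊ ≤ 1 / ⌊P'⌋₊ := by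
    rw [← Real.log_div hP'0.ne' hfP'0.ne']
    refine ⟨Real.log_nonneg (by rw [le_div_iff₀ hfP'0]; linarith), ?_⟩
    have := Real.log_le_sub_one_of_pos (show 0 < P' / ⌊P'⌋₊ by positivity)
    have e : P' / ⌊P'⌋₊ - 1 = (P' - ⌊P'⌋₊) / ⌊P'⌋₊ := by field_simp
    rw [e] at this
    refine this.trans ?_
    exact div_le_div_of_nonneg_right (by linarith) hfP'0.le
  have e : Real.log ((⌊P'⌋₊ : ℝ) / ⌊P⌋₊) - Real.log (P' / P) =
      (Real.log P - Real.log ⌊P⌋₊) - (Real.log P' - Real.log ⌊P'⌋₊) := by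
    rw [Real.log_div hfP'0.ne' hfP0.ne', Real.log_div hP'0.ne' hP0.ne']; ring
  rw [e]
  obtain ⟨hA1, hA2⟩ := hA
  obtain ⟨hB1, hB2⟩ := hB
  have h1 : 1 / (⌊P⌋₊ : ℝ) ≤ 2 / P := by
    rw [div_le_div_iff₀ hfP0 hP0]; linarith
  have h2 : 1 / (⌊P'⌋₊ : ℝ) ≤ 2 / P := by
    rw [div_le_div_iff₀ hfP'0 hP0]; linarith
  have h4 : (4 : ℝ) / P = 2 / P + 2 / P := by ring
  rw [abs_le]; constructor <;> linarith

/-- For `S ≥ 4` and `1 ≤ λ`: `|∑_{⌊S⌋ < s ≤ ⌊λS⌋} 1/s − log λ| ≤ 8/S`. [folklore] -/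
theorem abs_sum_cell_inv_sub_log_le {S lam : ℝ} (hS : 4 ≤ S) (hlam : 1 ≤ lam) :
    |∑ s ∈ Ioc ⌊S⌋₊ ⌊lam * S⌋₊, (1 : ℝ) / s - Real.log lam| ≤ 8 / S := by
  have hS0 : 0 < S := by linarith
  have hlam0 : 0 < lam := by linarith
  have hU1 : 1 ≤ ⌊S⌋₊ := Nat.le_floor (by norm_num; linarith)
  have hUV : ⌊S⌋₊ ≤ ⌊lam * S⌋₊ := Nat.floor_le_floor (le_mul_of_one_le_left hS0.le hlam)
  have h := abs_sum_Ioc_inv_sub_log_le hU1 hUV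
  have hl := abs_log_floor_div_floor_sub_le (P := S) (P' := lam * S) (by linarith)
    (le_mul_of_one_le_left hS0.le hlam)
  have e : lam * S / S = lam := by field_simp
  rw [e] at hl
  have hfS : (⌊S⌋₊ : ℝ) ≥ S - 1 := by have := Nat.lt_floor_add_one S; linarith
  have hfS0 : (0 : ℝ) < ⌊S⌋₊ := by linarith
  have h2 : 2 / (⌊S⌋₊ : ℝ) ≤ 4 / S := by
    rw [div_le_div_iff₀ hfS0 hS0]; nlinarith
  calc |∑ s ∈ Ioc ⌊S⌋₊ ⌊lam * S⌋₊, (1 : ℝ) / s - Real.log lam|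
      ≤ |∑ s ∈ Ioc ⌊S⌋₊ ⌊lam * S⌋₊, (1 : ℝ) / s - Real.log ((⌊lam * S⌋₊ : ℝ) / ⌊S⌋₊)| +
          |Real.log ((⌊lam * S⌋₊ : ℝ) / ⌊S⌋₊) - Real.log lam| := abs_sub_le _ _ _
    _ ≤ 2 / ⌊S⌋₊ + 4 / S := add_le_add h hl
    _ ≤ 4 / S + 4 / S := by linarith
    _ = 8 / S := by ring

/-- **The cells above a threshold are a geometric tail**: for `0 < s_lo`, `1 < λ`,
`∑_{j<J, S_j > s_lo} 1/S_j ≤ λ/((λ − 1) s_lo)` (`S_j = s_hi λ^{−(j+1)}`). [folklore] -/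
theorem sum_inv_sLow_le {shi lam slo : ℝ} (hlam : 1 < lam) (hslo : 0 < slo) (J : ℕ) :
    ∑ j ∈ (Finset.range J).filter (fun j => slo < sLow shi lam j), 1 / sLow shi lam j ≤
      lam / ((lam - 1) * slo) := by
  have hlam0 : 0 < lam := by linarith
  set F := (Finset.range J).filter (fun j => slo < sLow shi lam j) with hF
  rcases Finset.eq_empty_or_nonempty F with hFe | hFne
  · rw [hFe, Finset.sum_empty]; positivity
  -- the largest index in `F`
  set m := F.max' hFne with hm
  have hmF : m ∈ F := Finset.max'_mem F hFne
  have hSm : slo < sLow shi lam m := (Finset.mem_filter.1 hmF).2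
  have hSm0 : 0 < sLow shi lam m := hslo.trans hSm
  -- for `j ∈ F`: `S_j = S_m λ^{m-j}`, so `1/S_j = (1/S_m) (1/λ)^{m-j}`
  have hshi0' : 0 < shi := by
    by_contra h0
    push Not at h0
    have : sLow shi lam m ≤ 0 := by
      rw [sLow]; exact div_nonpos_of_nonpos_of_nonneg h0 (by positivity)
    linarith
  have hrel : ∀ j ∈ F, 1 / sLow shi lam j = (1 / sLow shi lam m) * (1 / lam) ^ (m - j) := by
    intro j hj
    have hjm : j ≤ m := Finset.le_max' F j hj
    rw [sLow, sLow, one_div_div, one_div_div, one_div_pow]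
    have e : lam ^ (m + 1) = lam ^ (j + 1) * lam ^ (m - j) := by
      rw [← pow_add]; congr 1; omega
    rw [e]
    field_simp
  rw [Finset.sum_congr rfl hrel, ← Finset.mul_sum]
  -- reindex `k = m - j`
  have hinj : Set.InjOn (fun j => m - j) (F : Set ℕ) := by
    intro j₁ h₁ j₂ h₂ h
    have := Finset.le_max' F j₁ h₁; have := Finset.le_max' F j₂ h₂
    simp only at h; omega
  have hsum : ∑ j ∈ F, (1 / lam) ^ (m - j) = ∑ k ∈ F.image (fun j => m - j), (1 / lam) ^ k := by
    rw [Finset.sum_image hinj]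
  rw [hsum]
  have hsub : F.image (fun j => m - j) ⊆ Finset.range (m + 1) := by
    intro k hk
    rw [Finset.mem_image] at hk
    obtain ⟨j, -, rfl⟩ := hk
    rw [Finset.mem_range]; omega
  have hx0 : 0 ≤ 1 / lam := by positivity
  have hx1 : 1 / lam < 1 := by rw [div_lt_one hlam0]; exact hlam
  calc 1 / sLow shi lam m * ∑ k ∈ F.image (fun j => m - j), (1 / lam) ^ k
      ≤ 1 / sLow shi lam m * ∑ k ∈ Finset.range (m + 1), (1 / lam) ^ k := by
        refine mul_le_mul_of_nonneg_left ?_ (by positivity)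
        exact Finset.sum_le_sum_of_subset_of_nonneg hsub fun _ _ _ => by positivity
    _ ≤ 1 / slo * (1 / (1 - 1 / lam)) := by
        have hgeom : ∑ k ∈ Finset.range (m + 1), (1 / lam) ^ k ≤ 1 / (1 - 1 / lam) := by
          have h := geom_sum_Ico_le_of_lt_one hx0 hx1 (m := 0) (n := m + 1)
          rwa [pow_zero, ← Finset.range_eq_Ico] at h
        refine mul_le_mul ?_ hgeom (Finset.sum_nonneg fun _ _ => by positivity) (by positivity)
        exact div_le_div_of_nonneg_left zero_le_one hslo hSm.le
    _ = lam / ((lam - 1) * slo) := by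
        field_simp

/-! ### The main estimate: nominal lengths against `y log(P'/P)` -/

/-- `λ S_j = s_hi/λ^j` (the upper end of the `j`-th cell). [folklore] -/
theorem lam_mul_sLow (shi : ℝ) {lam : ℝ} (hlam : lam ≠ 0) (j : ℕ) : lam * sLow shi lam j = shi / lam ^ j := by
  rw [sLow, pow_succ]; field_simp

set_option maxHeartbeats 1600000 in
/-- **The nominal lengths add up to `y log(P'/P)`** (BFI §13 p. 241: `q` and `s` "appear
symmetrically", here for the constant sequence): for `y ≥ 1`, `|a| ≤ y`, `2 ≤ P ≤ P' ≤ 2P`, `R₀ > 0`,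
`λ = 1 + η` (`0 < η ≤ 1`), `s_hi/λ^J < 1`, one `r₀ ∈ (R₀, λR₀]`, and `s_lo = (y − a)/(P'R₀) ≥ 4`,
`|∑_{j<J} ℓ_j log λ − y log(P'/P)| ≤ 27λ η y + 14λ y/P + 2λ P' R₀ + 8λ y/(η s_lo)`.
[cite: BombieriFriedlanderIwaniecActa1986, §13 p. 241–242] -/
theorem abs_sum_ell_mul_log_sub_le (a : ℤ) {y P P' R₀ lam η : ℝ} (hy : 1 ≤ y) (hay : |(a : ℝ)| ≤ y)
    (hP : 2 ≤ P) (hPP' : P ≤ P') (hP'2 : P' ≤ 2 * P) (hR₀ : 0 < R₀) (hη0 : 0 < η) (hη1 : η ≤ 1)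
    (hlam : lam = 1 + η) {J : ℕ} (hJ : sHi a y P R₀ / lam ^ J < 1) {r₀ : ℕ} (hr1 : R₀ < r₀)
    (hr2 : (r₀ : ℝ) ≤ lam * R₀) (hslo : 4 ≤ sLoT a y P' R₀) :
    |∑ j ∈ Finset.range J, ell a y P P' R₀ lam j * Real.log lam - y * Real.log (P' / P)| ≤
      27 * lam * η * y + 14 * lam * y / P + 2 * lam * P' * R₀ + 8 * lam * y / (η * sLoT a y P' R₀) := by
  have hy0 : 0 ≤ y := zero_le_one.trans hy
  have hP0 : 0 < P := by linarith
  have hP'0 : 0 < P' := by linarith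
  have hlam1 : 1 ≤ lam := by rw [hlam]; linarith
  have hlam1' : 1 < lam := by rw [hlam]; linarith
  have hlam0 : 0 < lam := by linarith
  have hlamη : lam ^ 2 - 1 ≤ 3 * η := by rw [hlam]; nlinarith
  have hr0r : (0 : ℝ) < r₀ := hR₀.trans hr1
  have hr0 : 0 < r₀ := by exact_mod_cast hr0r
  have hslo0 : 0 < sLoT a y P' R₀ := by linarith
  have hθ1 : 1 ≤ P' / P := by rw [le_div_iff₀ hP0]; linarith
  have hlogθ0 : 0 ≤ Real.log (P' / P) := Real.log_nonneg hθ1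
  have hloglam0 : 0 ≤ Real.log lam := Real.log_nonneg hlam1
  have hloglamη : Real.log lam ≤ η := by
    rw [hlam]; have := Real.log_le_sub_one_of_pos (show 0 < 1 + η by linarith); linarith
  set shi := sHi a y P R₀ with hshi
  set slo := sLoT a y P' R₀ with hslo'
  have hshi0 : 0 ≤ shi := by
    rw [hshi, sHi]; refine div_nonneg ?_ (by positivity); linarith [le_abs_self (a : ℝ)]
  have hshile : shi ≤ 3 * y / (P * R₀) := by
    rw [hshi, sHi]; refine div_le_div_of_nonneg_right ?_ (by positivity); linarith [neg_abs_le (a : ℝ)]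
  have hrshi : (r₀ : ℝ) * shi ≤ 3 * lam * y / P := by
    calc (r₀ : ℝ) * shi ≤ (lam * R₀) * (3 * y / (P * R₀)) := mul_le_mul hr2 hshile hshi0 (by positivity)
      _ = 3 * lam * y / P := by field_simp
  have hRHS0 : 0 ≤ 14 * lam * y / P + 2 * lam * P' * R₀ + 8 * lam * y / (η * slo) := by positivity
  -- abbreviations
  set L : ℕ → ℝ := fun j => ell a y P P' R₀ lam j with hLdef
  have hL0 : ∀ j, 0 ≤ L j := fun j => (ell_bounds a hy0 P P' R₀ lam j).1
  have hLy : ∀ j, L j ≤ y := fun j => (ell_bounds a hy0 P P' R₀ lam j).2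
  -- Case A: `P'/P ≤ λ²`: all nominal intervals are empty
  by_cases hθ : P' / P ≤ lam ^ 2
  · have hzero : ∀ j, L j = 0 := by
      intro j
      simp only [hLdef, ell]
      refine le_antisymm (max_le le_rfl ?_) (le_max_left _ _)
      rw [cHi, cLo]
      have hS0 : 0 ≤ sLow shi lam j := by rw [sLow]; positivity
      have h1 : min (2 * y) ((a : ℝ) + P' * R₀ * sLow shi lam j) ≤ (a : ℝ) + P' * R₀ * sLow shi lam j := min_le_right _ _
      have h2 : (a : ℝ) + P * lam ^ 2 * R₀ * sLow shi lam j ≤ max y ((a : ℝ) + P * lam ^ 2 * R₀ * sLow shi lam j) :=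
        le_max_right _ _
      have h3 : P' ≤ P * lam ^ 2 := by rwa [div_le_iff₀ hP0, mul_comm] at hθ
      have : P' * R₀ * sLow shi lam j ≤ P * lam ^ 2 * R₀ * sLow shi lam j := by
        have := mul_le_mul_of_nonneg_right h3 (mul_nonneg hR₀.le hS0); nlinarith
      linarith
    have hsum0 : ∑ j ∈ Finset.range J, L j * Real.log lam = 0 :=
      Finset.sum_eq_zero fun j _ => by rw [hzero j, zero_mul]
    rw [hsum0, zero_sub, abs_neg, abs_of_nonneg (by positivity)]
    have h1 : Real.log (P' / P) ≤ 2 * Real.log lam := by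
      have e : Real.log (lam ^ 2) = 2 * Real.log lam := by
        rw [Real.log_pow]; norm_num
      rw [← e]; exact Real.log_le_log (by positivity) hθ
    have hηy : 0 ≤ η * y := by positivity
    calc y * Real.log (P' / P) ≤ y * (2 * η) := mul_le_mul_of_nonneg_left (by linarith) hy0
      _ ≤ 27 * η * y := by nlinarith
      _ ≤ 27 * lam * η * y := by nlinarith [mul_le_mul_of_nonneg_right hlam1 hηy]
      _ ≤ _ := by linarith
  push Not at hθ
  -- Case B.
  -- Step 1: the counting switch, cells
  have hsw := sum_Ioc_cntSum_eq_sum_swCnt a hy hay hR₀ hr1 hP0 (P' := P')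
  rw [← hshi] at hsw
  rw [sum_Icc_floor_eq_sum_geomBlocks (fun s => swCnt a y P P' r₀ s) hshi0 hlam1 hJ] at hsw
  -- the cells as `sCell`
  change ∑ q ∈ Ioc ⌊P⌋₊ ⌊P'⌋₊, cntSum a y (q * r₀) =
    ∑ j ∈ Finset.range J, ∑ s ∈ sCell shi lam j, swCnt a y P P' r₀ s at hsw
  -- Step 2: the `q`-side
  set Hq : ℝ := ∑ q ∈ Ioc ⌊P⌋₊ ⌊P'⌋₊, (1 : ℝ) / q with hHq
  have hstep2 : |∑ q ∈ Ioc ⌊P⌋₊ ⌊P'⌋₊, cntSum a y (q * r₀) - y / r₀ * Hq| ≤ 2 * P' := by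
    rw [hHq, Finset.mul_sum, ← Finset.sum_sub_distrib]
    refine (Finset.abs_sum_le_sum_abs _ _).trans ?_
    have hterm : ∀ q ∈ Ioc ⌊P⌋₊ ⌊P'⌋₊, |cntSum a y (q * r₀) - y / r₀ * (1 / q)| ≤ 2 := by
      intro q hq
      have hq0 : 0 < q := by have := (Finset.mem_Ioc.1 hq).1; omega
      have h := abs_cntSum_sub_le a hy (Nat.mul_pos hq0 hr0)
      have e : y / ((q * r₀ : ℕ) : ℝ) = y / r₀ * (1 / q) := by push_cast; field_simp
      rwa [e] at h
    refine (Finset.sum_le_sum hterm).trans ?_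
    rw [Finset.sum_const, nsmul_eq_mul, Nat.card_Ioc]
    have h1 : ((⌊P'⌋₊ - ⌊P⌋₊ : ℕ) : ℝ) ≤ P' := by
      have : ((⌊P'⌋₊ - ⌊P⌋₊ : ℕ) : ℝ) ≤ ⌊P'⌋₊ := by exact_mod_cast Nat.sub_le _ _
      exact this.trans (Nat.floor_le hP'0.le)
    linarith
  -- Step 3: the `s`-side counts against the true lengths
  set Hj : ℕ → ℝ := fun j => ∑ s ∈ sCell shi lam j, (1 : ℝ) / s with hHjdef
  have hcard := sum_card_sCell_eq hshi0 hlam1 hJ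
  have hstep3 : |∑ j ∈ Finset.range J, ∑ s ∈ sCell shi lam j, swCnt a y P P' r₀ s -
      1 / r₀ * ∑ j ∈ Finset.range J, ∑ s ∈ sCell shi lam j, trueLen a y P P' r₀ s / s| ≤ 2 * shi := by
    rw [Finset.mul_sum, ← Finset.sum_sub_distrib]
    refine (Finset.abs_sum_le_sum_abs _ _).trans ?_
    have hterm : ∀ j ∈ Finset.range J, |∑ s ∈ sCell shi lam j, swCnt a y P P' r₀ s -
        1 / r₀ * ∑ s ∈ sCell shi lam j, trueLen a y P P' r₀ s / s| ≤ 2 * ((sCell shi lam j).card : ℝ) := by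
      intro j _
      rw [Finset.mul_sum, ← Finset.sum_sub_distrib]
      refine (Finset.abs_sum_le_sum_abs _ _).trans ?_
      have ht : ∀ s ∈ sCell shi lam j, |swCnt a y P P' r₀ s - 1 / r₀ * (trueLen a y P P' r₀ s / s)| ≤ 2 := by
        intro s hs
        have hs0 : 0 < s := by rw [sCell, Finset.mem_Ioc] at hs; omega
        have h := abs_swCnt_sub_le a hy0 hr0 hs0 (P := P) (P' := P')
        have e : trueLen a y P P' r₀ s / ((s * r₀ : ℕ) : ℝ) = 1 / r₀ * (trueLen a y P P' r₀ s / s) := by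
          push_cast; field_simp
        rwa [e] at h
      refine (Finset.sum_le_sum ht).trans ?_
      rw [Finset.sum_const, nsmul_eq_mul, mul_comm]
    refine (Finset.sum_le_sum hterm).trans ?_
    rw [← Finset.mul_sum, hcard]
    have := Nat.floor_le hshi0
    linarith
  -- Step 4: true lengths against nominal lengths
  have hstep4 : |1 / r₀ * ∑ j ∈ Finset.range J, ∑ s ∈ sCell shi lam j, trueLen a y P P' r₀ s / s -
      1 / r₀ * ∑ j ∈ Finset.range J, L j * Hj j| ≤ 9 * η * P * shi := by
    rw [← mul_sub, ← Finset.sum_sub_distrib, abs_mul, abs_of_pos (by positivity : (0 : ℝ) < 1 / r₀)]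
    have hterm : ∀ j ∈ Finset.range J, |∑ s ∈ sCell shi lam j, trueLen a y P P' r₀ s / s - L j * Hj j| ≤
        9 * η * P * r₀ * ((sCell shi lam j).card : ℝ) := by
      intro j _
      simp only [hHjdef]
      rw [Finset.mul_sum, ← Finset.sum_sub_distrib]
      refine (Finset.abs_sum_le_sum_abs _ _).trans ?_
      have hS0 : 0 ≤ sLow shi lam j := by rw [sLow]; positivity
      have ht : ∀ s ∈ sCell shi lam j, |trueLen a y P P' r₀ s / s - L j * (1 / s)| ≤ 9 * η * P * r₀ := by
        intro s hs
        obtain ⟨hs1, hs2⟩ := mem_sCell_bounds hshi0 hlam0 hs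
        have hs0r : (0 : ℝ) < s := hS0.trans_lt hs1
        have hlo := ell_le_trueLen a hP0.le hP'0.le hR₀.le hS0 hr1 hr2 hs1 hs2
        have hhi := trueLen_le_ell_add a hP0.le hPP' hP'2 hR₀.le hη0.le hlam1 hlamη hS0 hr1 hr2 hs1 hs2
        have e : trueLen a y P P' r₀ s / s - L j * (1 / s) = (trueLen a y P P' r₀ s - L j) / s := by
          field_simp
        rw [e, abs_div, abs_of_pos hs0r, div_le_iff₀ hs0r, abs_of_nonneg (by simp only [hLdef]; linarith)]
        simp only [hLdef]
        nlinarith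
      refine (Finset.sum_le_sum ht).trans ?_
      rw [Finset.sum_const, nsmul_eq_mul, mul_comm]
    refine (mul_le_mul_of_nonneg_left ((Finset.abs_sum_le_sum_abs _ _).trans (Finset.sum_le_sum hterm))
      (by positivity)).trans ?_
    rw [← Finset.mul_sum, hcard]
    have := Nat.floor_le hshi0
    have e : 1 / (r₀ : ℝ) * (9 * η * P * r₀ * ⌊shi⌋₊) = 9 * η * P * ⌊shi⌋₊ := by field_simp
    rw [e]
    exact mul_le_mul_of_nonneg_left this (by positivity)
  -- Step 5: combine 1–4
  have hstep5 : |∑ j ∈ Finset.range J, L j * Hj j - y * Hq| ≤ r₀ * (2 * P' + (2 + 9 * η * P) * shi) := by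
    have h5' : |1 / r₀ * ∑ j ∈ Finset.range J, L j * Hj j - y / r₀ * Hq| ≤ 2 * P' + 2 * shi + 9 * η * P * shi := by
      have e : 1 / r₀ * ∑ j ∈ Finset.range J, L j * Hj j - y / r₀ * Hq =
          (1 / r₀ * ∑ j ∈ Finset.range J, L j * Hj j -
              1 / r₀ * ∑ j ∈ Finset.range J, ∑ s ∈ sCell shi lam j, trueLen a y P P' r₀ s / s) +
          (1 / r₀ * ∑ j ∈ Finset.range J, ∑ s ∈ sCell shi lam j, trueLen a y P P' r₀ s / s -
              ∑ j ∈ Finset.range J, ∑ s ∈ sCell shi lam j, swCnt a y P P' r₀ s) +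
          (∑ q ∈ Ioc ⌊P⌋₊ ⌊P'⌋₊, cntSum a y (q * r₀) - y / r₀ * Hq) := by rw [hsw]; ring
      rw [e]
      refine (abs_add_three _ _ _).trans ?_
      rw [abs_sub_comm] at hstep4
      rw [abs_sub_comm] at hstep3
      linarith
    have e : ∑ j ∈ Finset.range J, L j * Hj j - y * Hq =
        r₀ * (1 / r₀ * ∑ j ∈ Finset.range J, L j * Hj j - y / r₀ * Hq) := by field_simp
    rw [e, abs_mul, abs_of_pos hr0r]
    refine mul_le_mul_of_nonneg_left (h5'.trans (le_of_eq (by ring))) hr0r.le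
  -- Step 6: the harmonic sum over the `q`-block
  have hstep6 : |Hq - Real.log (P' / P)| ≤ 8 / P := by
    have hU1 : 1 ≤ ⌊P⌋₊ := Nat.le_floor (by norm_num; linarith)
    have hUV : ⌊P⌋₊ ≤ ⌊P'⌋₊ := Nat.floor_le_floor hPP'
    have h1 := abs_sum_Ioc_inv_sub_log_le hU1 hUV
    have h2 := abs_log_floor_div_floor_sub_le hP hPP'
    have hfP : (⌊P⌋₊ : ℝ) ≥ P - 1 := by have := Nat.lt_floor_add_one P; linarith
    have hfP0 : (0 : ℝ) < ⌊P⌋₊ := by linarith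
    have h3 : 2 / (⌊P⌋₊ : ℝ) ≤ 4 / P := by rw [div_le_div_iff₀ hfP0 hP0]; nlinarith
    calc |Hq - Real.log (P' / P)| ≤ |Hq - Real.log ((⌊P'⌋₊ : ℝ) / ⌊P⌋₊)| +
          |Real.log ((⌊P'⌋₊ : ℝ) / ⌊P⌋₊) - Real.log (P' / P)| := abs_sub_le _ _ _
      _ ≤ 2 / ⌊P⌋₊ + 4 / P := add_le_add h1 h2
      _ ≤ 8 / P := by have : (8 : ℝ) / P = 4 / P + 4 / P := by ring
                      linarith
  -- Step 7: the harmonic sums over the cells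
  have hstep7 : |∑ j ∈ Finset.range J, L j * Hj j - ∑ j ∈ Finset.range J, L j * Real.log lam| ≤
      8 * lam * y / (η * slo) := by
    rw [← Finset.sum_sub_distrib]
    refine (Finset.abs_sum_le_sum_abs _ _).trans ?_
    have hterm : ∀ j ∈ Finset.range J, |L j * Hj j - L j * Real.log lam| ≤
        if slo < sLow shi lam j then 8 * y * (1 / sLow shi lam j) else 0 := by
      intro j _
      rw [← mul_sub, abs_mul, abs_of_nonneg (hL0 j)]
      have hS0 : 0 ≤ sLow shi lam j := by rw [sLow]; positivity
      rcases (hL0 j).eq_or_lt with hz | hpos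
      · rw [← hz, zero_mul]
        split_ifs
        · exact mul_nonneg (by positivity) (one_div_nonneg.2 hS0)
        · exact le_rfl
      · have hSj : slo < sLow shi lam j := sLoT_lt_of_ell_pos a hP'0 hR₀ hpos
        rw [if_pos hSj]
        have hS4 : 4 ≤ sLow shi lam j := hslo.trans hSj.le
        have hh := abs_sum_cell_inv_sub_log_le hS4 hlam1
        rw [lam_mul_sLow shi hlam0.ne'] at hh
        have hHj : Hj j = ∑ s ∈ Ioc ⌊sLow shi lam j⌋₊ ⌊shi / lam ^ j⌋₊, (1 : ℝ) / s := by
          simp only [hHjdef, sCell, sLow]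
        rw [← hHj] at hh
        calc L j * |Hj j - Real.log lam| ≤ y * (8 / sLow shi lam j) := mul_le_mul (hLy j) hh (abs_nonneg _) hy0
          _ = 8 * y * (1 / sLow shi lam j) := by ring
    refine (Finset.sum_le_sum hterm).trans ?_
    rw [← Finset.sum_filter, ← Finset.mul_sum]
    have hg := sum_inv_sLow_le hlam1' hslo0 J (shi := shi) (slo := slo)
    calc 8 * y * ∑ j ∈ (Finset.range J).filter (fun j => slo < sLow shi lam j), 1 / sLow shi lam j
        ≤ 8 * y * (lam / ((lam - 1) * slo)) := mul_le_mul_of_nonneg_left hg (by positivity)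
      _ = 8 * lam * y / (η * slo) := by
          rw [show lam - 1 = η by rw [hlam]; ring]
          field_simp
  -- Step 8: assemble
  have hmain : |∑ j ∈ Finset.range J, L j * Real.log lam - y * Real.log (P' / P)| ≤
      8 * lam * y / (η * slo) + r₀ * (2 * P' + (2 + 9 * η * P) * shi) + y * (8 / P) := by
    have e : ∑ j ∈ Finset.range J, L j * Real.log lam - y * Real.log (P' / P) =
        (∑ j ∈ Finset.range J, L j * Real.log lam - ∑ j ∈ Finset.range J, L j * Hj j) +
        (∑ j ∈ Finset.range J, L j * Hj j - y * Hq) + y * (Hq - Real.log (P' / P)) := by ring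
    rw [e]
    refine (abs_add_three _ _ _).trans ?_
    rw [abs_sub_comm] at hstep7
    have h3 : |y * (Hq - Real.log (P' / P))| ≤ y * (8 / P) := by
      rw [abs_mul, abs_of_nonneg hy0]; exact mul_le_mul_of_nonneg_left hstep6 hy0
    linarith
  refine hmain.trans ?_
  -- numerics: `r₀ ≤ λR₀`, `r₀ s_hi ≤ 3λy/P`
  have h1 : (r₀ : ℝ) * (2 * P' + (2 + 9 * η * P) * shi) ≤ 2 * lam * P' * R₀ + (2 + 9 * η * P) * (3 * lam * y / P) := by
    have e : (r₀ : ℝ) * (2 * P' + (2 + 9 * η * P) * shi) = 2 * P' * r₀ + (2 + 9 * η * P) * (r₀ * shi) := by ring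
    rw [e]
    have := mul_le_mul_of_nonneg_left hr2 (by positivity : (0 : ℝ) ≤ 2 * P')
    have := mul_le_mul_of_nonneg_left hrshi (by positivity : (0 : ℝ) ≤ 2 + 9 * η * P)
    linarith
  have e2 : (2 + 9 * η * P) * (3 * lam * y / P) = 6 * lam * y / P + 27 * lam * η * y := by
    field_simp
    ring
  have h3 : y * (8 / P) ≤ 8 * lam * y / P := by
    rw [mul_div_assoc', div_le_div_iff_of_pos_right hP0]; nlinarith
  rw [e2] at h1
  have : 8 * lam * y / (η * slo) + (2 * lam * P' * R₀ + (6 * lam * y / P + 27 * lam * η * y)) + 8 * lam * y / P =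
      27 * lam * η * y + 14 * lam * y / P + 2 * lam * P' * R₀ + 8 * lam * y / (η * slo) := by ring
  linarith

end BFI

end Literature.NumberTheory.Sieve
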